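import Literature.MathematicalPhysics.QuantumFieldTheory.OSTimeTubeRotationIdentity
import Literature.MathematicalPhysics.QuantumFieldTheory.OSTimeTubeBoostSlices
import HarnessLib

/-!
# The infinitesimal boost identity of an OS time continuation along temporal rays

Support file (everything proved; no definitions, no named facts) for (B)
`Literature.MathematicalPhysics.QuantumFieldTheory.OS1973_lorentzInvariant_of_timeContinuation`
(`OSTimeContinuation`; Osterwalder–Schrader I (1973), §4.2, (4.14)–(4.17): "relativistic
invariance of `W̃ₙ` follows from (4.15)–(4.17) and the uniqueness theorem for Laplace and Fourier
transforms of distributions"). Here the passage from the infinitesimal Euclidean rotations to the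
infinitesimal boosts is made on the time tube, in position space: the rotation identity
`∑ₖ ∂ₖ K_{y_k^j ψ}(w) = ∑ₖ w_k K_{∂_{k,j}ψ}(w)` on the complex time tube
(`OSTimeTubeRotationIdentity`), taken at the points `w = x⁰ + itη⁰` of a temporal ray and
integrated against a test function in the real times (Fubini over times and spatial parts,
`OSTimeSpaceSplit`, and an integration by parts in each real time, `OSTimeTubeBoostSlices`),
gives the **weak infinitesimal boost identity along the ray** `x + itη`:

  `∫ 𝔚(x + itη) DF(x)(b x) dx = −it ∫ 𝔚(x + itη) ∑ₖ η⁰_k ∂_{(k,j)}F(x) dx`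
  (`integral_rayC_mul_fderiv_boostGen`),

`(b x)_k = x_k^j e₀ + x_k⁰ e_j` the generator of the boosts in the `(0, j)`-plane acting
diagonally (`X_{0j}` of OS I (4.14), in position space), for every smooth compactly supported `F`
and every `t > 0`. The right side carries the factor `t`: letting `t → 0⁺` in the sequel gives
`T(X_{0j} F) = 0` for the time-ray boundary value `T`.

## References

* K. Osterwalder, R. Schrader, *Axioms for Euclidean Green's functions*, Comm. Math. Phys. 31
  (1973) 83–112, §4.2, (4.14)–(4.17). [OsterwalderSchraderCMP1973]
* K. Osterwalder, R. Schrader, *Axioms for Euclidean Green's functions II*, Comm. Math. Phys. 42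
  (1975) 281–305, §IV.2 p. 288. [OsterwalderSchraderCMP1975]
-/

noncomputable section

open Filter Complex Set MeasureTheory Metric
open scoped Topology SchwartzMap ContDiff
open Literature.MathematicalPhysics.QuantumLattice

namespace Literature.MathematicalPhysics.QuantumFieldTheory

variable {d n : ℕ} {S : SchwingerFamily (EuclideanSpace ℝ (Fin (d + 1)))}
  {𝔚 : (Fin n → Fin (d + 1) → ℂ) → ℂ}

/-- The time continuation along a temporal ray, at an assembled configuration, in time–space
coordinates: `𝔚((u, y) + itη) = 𝔚 (tsCfg (u + itη⁰) y)`. [folklore] -/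
theorem apply_rayC_timeSpace {η : Fin n → SpaceTime d} (hη : η ∈ temporalCone d n) (l : ℂ)
    (u : Fin n → ℝ) (y : Fin n → EuclideanSpace ℝ (Fin d)) :
    𝔚 (rayC (fun k => ofTimeSpace (u k) (y k)) η l) =
      𝔚 (tsCfg (fun k => ((u k : ℝ) : ℂ) + l * (η k 0 : ℂ)) y) := by
  rw [rayC_eq_tsCfg _ hη]
  simp

/-- The space slices of a smooth function are smooth. [folklore] -/
theorem contDiff_comp_timeSpace_right {F : (Fin n → SpaceTime d) → ℂ} {m : WithTop ℕ∞}
    (hF : ContDiff ℝ m F) (u : Fin n → ℝ) :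
    ContDiff ℝ m fun y : Fin n → EuclideanSpace ℝ (Fin d) => F fun k => ofTimeSpace (u k) (y k) := by
  obtain ⟨L, hL⟩ := exists_clm_spaceEmbed (d := d) (n := n)
  have hfun : (fun y : Fin n → EuclideanSpace ℝ (Fin d) => F fun k => ofTimeSpace (u k) (y k)) =
      fun y => F (L y + fun k => (u k) • e₀ d) := by
    funext y
    congr 1
    funext k
    rw [hL, Pi.add_apply, add_comm]
    exact ofTimeSpace_eq_smul_e₀_add (u k) (y k)
  rw [hfun]
  exact hF.comp (L.contDiff.add contDiff_const)

/-- **The weak infinitesimal boost identity along a temporal ray** (Osterwalder–Schrader I (1973),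
§4.2, the position-space form of (4.14)–(4.17) on the time tube): if `𝔖ₙ` is Euclidean covariant
and `𝔚` is continuous on the time tube, holomorphic in the times, with Euclidean restriction `𝔖ₙ` on
time-ordered test functions, then for every temporal direction `η`, every `t > 0`, every smooth
compactly supported `F` and every spatial direction `j`,
`∫ 𝔚(x + itη) DF(x)(b x) dx = −it ∫ 𝔚(x + itη) ∑ₖ η⁰_k ∂_{(k,j)}F(x) dx`,
`(b x)_k = x_k^j e₀ + x_k⁰ e_j`. [cite: OsterwalderSchraderCMP1973, §4.2 eqs. (4.14)–(4.17)] -/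
theorem integral_rayC_mul_fderiv_boostGen (hE1 : S.IsEuclideanCovariant)
    (hc : ContinuousOn 𝔚 (timeTube d n)) (hh : IsTimeHolomorphicOn 𝔚 (timeTube d n))
    (hS : ∀ F : 𝓢((Fin n → EuclideanSpace ℝ (Fin (d + 1))), ℂ), IsTimeOrdered F →
      S n F = ∫ x, 𝔚 (euclideanPoint x) * F x)
    (j : Fin d) {η : Fin n → SpaceTime d} (hη : η ∈ temporalCone d n) {t : ℝ} (ht : 0 < t)
    {F : (Fin n → SpaceTime d) → ℂ} (hF : ContDiff ℝ ∞ F) (hFc : HasCompactSupport F) :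
    ∫ x, 𝔚 (rayC x η ((t : ℂ) * I)) *
        fderiv ℝ F x (fun k => (x k j.succ) • e₀ d + (x k 0) • EuclideanSpace.single j.succ (1 : ℝ)) =
      -(((t : ℂ) * I) * ∫ x, 𝔚 (rayC x η ((t : ℂ) * I)) *
        ∑ k, ((η k 0 : ℝ) : ℂ) * fderiv ℝ F x (Pi.single k (EuclideanSpace.single j.succ (1 : ℝ)))) := by
  have hIt : 0 < ((t : ℂ) * I).im := by simpa using ht
  have hF1 : ContDiff ℝ 1 F := hF.of_le (by simp)
  have hFd : Differentiable ℝ F := hF.differentiable (by simp)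
  have hFdc : Continuous (fderiv ℝ F) := hF.continuous_fderiv (by simp)
  -- the times along the ray
  set c : Fin n → ℂ := fun k => ((t : ℂ) * I) * (η k 0 : ℂ) with hc_def
  have hcT : ∀ u : Fin n → ℝ, (fun k => ((u k : ℝ) : ℂ) + c k) ∈ cTimeTube n := fun u => by
    simpa [hc_def] using rayTimes_mem_cTimeTube (fun k => (ofTimeSpace (u k) (0 : EuclideanSpace ℝ (Fin d)) :
      SpaceTime d)) hη hIt
  -- the ray function and its values at assembled configurations
  have hVc : Continuous fun x : Fin n → SpaceTime d => 𝔚 (rayC x η ((t : ℂ) * I)) :=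
    continuous_comp_rayC_of_continuousOn_timeTube hc hη hIt
  have hVasm : ∀ (u : Fin n → ℝ) (y : Fin n → EuclideanSpace ℝ (Fin d)),
      𝔚 (rayC (fun k => ofTimeSpace (u k) (y k)) η ((t : ℂ) * I)) =
        𝔚 (tsCfg (fun k => ((u k : ℝ) : ℂ) + c k) y) := fun u y => apply_rayC_timeSpace hη _ u y
  -- continuity and support of the partial derivatives of `F`
  have hdF : ∀ v : Fin n → SpaceTime d, Continuous fun x => fderiv ℝ F x v := fun v =>
    hFdc.clm_apply continuous_const
  have hdFc : ∀ v : Fin n → SpaceTime d, HasCompactSupport fun x => fderiv ℝ F x v := fun v =>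
    hFc.fderiv_apply ℝ v
  have hcoord : ∀ (k : Fin n) (μ : Fin (d + 1)), Continuous fun x : Fin n → SpaceTime d =>
      ((x k μ : ℝ) : ℂ) := fun k μ =>
    continuous_ofReal.comp ((EuclideanSpace.proj μ).continuous.comp (continuous_apply k))
  have hcoordY : ∀ k : Fin n, Continuous fun y : Fin n → EuclideanSpace ℝ (Fin d) =>
      ((y k j : ℝ) : ℂ) := fun k =>
    continuous_ofReal.comp ((EuclideanSpace.proj j).continuous.comp (continuous_apply k))
  -- Step 1: expansion of the generator and linearity
  have hI0 : ∀ k, Integrable fun x : Fin n → SpaceTime d => 𝔚 (rayC x η ((t : ℂ) * I)) *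
      (((x k j.succ : ℝ) : ℂ) * fderiv ℝ F x (Pi.single k (e₀ d))) := fun k =>
    (hVc.mul ((hcoord k j.succ).mul (hdF _))).integrable_of_hasCompactSupport
      (hdFc _).mul_left.mul_left
  have hIj : ∀ k, Integrable fun x : Fin n → SpaceTime d => 𝔚 (rayC x η ((t : ℂ) * I)) *
      (((x k 0 : ℝ) : ℂ) * fderiv ℝ F x (Pi.single k (EuclideanSpace.single j.succ (1 : ℝ)))) :=
    fun k => (hVc.mul ((hcoord k 0).mul (hdF _))).integrable_of_hasCompactSupport
      (hdFc _).mul_left.mul_left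
  have hstep1 : ∫ x, 𝔚 (rayC x η ((t : ℂ) * I)) *
      fderiv ℝ F x (fun k => (x k j.succ) • e₀ d + (x k 0) • EuclideanSpace.single j.succ (1 : ℝ)) =
      (∑ k, ∫ x, 𝔚 (rayC x η ((t : ℂ) * I)) * (((x k j.succ : ℝ) : ℂ) * fderiv ℝ F x (Pi.single k (e₀ d)))) +
        ∑ k, ∫ x, 𝔚 (rayC x η ((t : ℂ) * I)) *
          (((x k 0 : ℝ) : ℂ) * fderiv ℝ F x (Pi.single k (EuclideanSpace.single j.succ (1 : ℝ)))) := by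
    rw [← integral_finsetSum _ fun k _ => hI0 k, ← integral_finsetSum _ fun k _ => hIj k,
      ← integral_add (integrable_finsetSum _ fun k _ => hI0 k) (integrable_finsetSum _ fun k _ => hIj k)]
    congr 1
    funext x
    rw [fderiv_apply_boostGen F j x, Finset.mul_sum, ← Finset.sum_add_distrib]
    refine Finset.sum_congr rfl fun k _ => ?_
    ring
  -- Step 2: the time-derivative terms, by Fubini and integration by parts in the `k`-th time
  have hT1 : ∀ k, ∫ x, 𝔚 (rayC x η ((t : ℂ) * I)) * (((x k j.succ : ℝ) : ℂ) * fderiv ℝ F x (Pi.single k (e₀ d))) =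
      -∫ u : Fin n → ℝ, ∫ y : Fin n → EuclideanSpace ℝ (Fin d),
        fderiv ℂ (fun w => 𝔚 (tsCfg w y)) (fun k => ((u k : ℝ) : ℂ) + c k) (Pi.single k (1 : ℂ)) *
          (((y k j : ℝ) : ℂ) * F (fun k => ofTimeSpace (u k) (y k))) := by
    intro k
    rw [integral_eq_integral_integral_timeSpace_symm (hI0 k)]
    simp only [hVasm, ofTimeSpace_apply_succ]
    have hbp : ∀ y : Fin n → EuclideanSpace ℝ (Fin d),
        ∫ u : Fin n → ℝ, 𝔚 (tsCfg (fun k => ((u k : ℝ) : ℂ) + c k) y) *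
          (((y k j : ℝ) : ℂ) * fderiv ℝ F (fun k => ofTimeSpace (u k) (y k)) (Pi.single k (e₀ d))) =
        -∫ u : Fin n → ℝ, fderiv ℂ (fun w => 𝔚 (tsCfg w y)) (fun k => ((u k : ℝ) : ℂ) + c k)
          (Pi.single k (1 : ℂ)) * (((y k j : ℝ) : ℂ) * F (fun k => ofTimeSpace (u k) (y k))) :=
      fun y => integral_rayTimes_mul_fderiv_time hc hh hcT hF1 hFc y k _
    simp only [hbp, integral_neg]
    congr 1
    have hsw := (integrable_fderiv_rayTimes_mul hc hh hcT hF.continuous hFc (hcoordY k)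
      (Pi.single k (1 : ℂ))).swap
    exact integral_integral_swap hsw
  -- Step 3: the rotation identity on the complex time tube at the times `u + itη⁰`
  have hsum : ∀ u : Fin n → ℝ,
      ∑ k, ∫ y : Fin n → EuclideanSpace ℝ (Fin d),
        fderiv ℂ (fun w => 𝔚 (tsCfg w y)) (fun k => ((u k : ℝ) : ℂ) + c k) (Pi.single k (1 : ℂ)) *
          (((y k j : ℝ) : ℂ) * F (fun k => ofTimeSpace (u k) (y k))) =
      ∑ k, (((u k : ℝ) : ℂ) + c k) * ∫ y : Fin n → EuclideanSpace ℝ (Fin d),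
        𝔚 (tsCfg (fun k => ((u k : ℝ) : ℂ) + c k) y) *
          fderiv ℝ F (fun k => ofTimeSpace (u k) (y k)) (Pi.single k (EuclideanSpace.single j.succ (1 : ℝ))) := by
    intro u
    have hψ : ContDiff ℝ ∞ fun y : Fin n → EuclideanSpace ℝ (Fin d) => F fun k => ofTimeSpace (u k) (y k) :=
      contDiff_comp_timeSpace_right hF u
    have hψc : HasCompactSupport fun y : Fin n → EuclideanSpace ℝ (Fin d) =>
        F fun k => ofTimeSpace (u k) (y k) := hasCompactSupport_comp_timeSpace_right hFc u
    have hχ : ∀ k, Continuous fun y : Fin n → EuclideanSpace ℝ (Fin d) =>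
        ((y k j : ℝ) : ℂ) * F (fun k => ofTimeSpace (u k) (y k)) := fun k => (hcoordY k).mul hψ.continuous
    have hχc : ∀ k, HasCompactSupport fun y : Fin n → EuclideanSpace ℝ (Fin d) =>
        ((y k j : ℝ) : ℂ) * F (fun k => ofTimeSpace (u k) (y k)) := fun k => hψc.mul_left
    have key := sum_fderiv_smearing_eq_sum_mul_smearing hE1 hc hh hS j hψ hψc (hcT u)
    calc ∑ k, ∫ y : Fin n → EuclideanSpace ℝ (Fin d),
          fderiv ℂ (fun w => 𝔚 (tsCfg w y)) (fun k => ((u k : ℝ) : ℂ) + c k) (Pi.single k (1 : ℂ)) *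
            (((y k j : ℝ) : ℂ) * F (fun k => ofTimeSpace (u k) (y k)))
        = ∑ k, fderiv ℂ (fun w => ∫ y : Fin n → EuclideanSpace ℝ (Fin d), 𝔚 (tsCfg w y) *
            (((y k j : ℝ) : ℂ) * F (fun k => ofTimeSpace (u k) (y k))))
            (fun k => ((u k : ℝ) : ℂ) + c k) (Pi.single k (1 : ℂ)) :=
          Finset.sum_congr rfl fun k _ => (fderiv_integral_tsCfg_mul hc hh (hχ k) (hχc k) (hcT u) _).symm
      _ = _ := key
      _ = _ := by
          refine Finset.sum_congr rfl fun k _ => ?_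
          simp only [fderiv_comp_timeSpace_right hFd u]
  -- Step 4: the remaining terms as an integral over configurations
  have hWu : ∀ u : Fin n → ℝ, Continuous fun y : Fin n → EuclideanSpace ℝ (Fin d) =>
      𝔚 (tsCfg (fun k => ((u k : ℝ) : ℂ) + c k) y) := fun u => hc.tsCfg_space (hcT u)
  have hsuppF : ∀ {g : (Fin n → SpaceTime d) → ℂ}, (∀ x, x ∉ tsupport F → g x = 0) →
      HasCompactSupport g := fun hg =>
    HasCompactSupport.of_support_subset_isCompact hFc fun x hx => by
      by_contra hx'
      exact hx (hg x hx')
  have hzero : ∀ {x : Fin n → SpaceTime d} (v : Fin n → SpaceTime d), x ∉ tsupport F →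
      fderiv ℝ F x v = 0 := fun v hx => by
    rw [fderiv_of_notMem_tsupport ℝ hx]; rfl
  have hIc : Integrable fun x : Fin n → SpaceTime d => 𝔚 (rayC x η ((t : ℂ) * I)) *
      ∑ k, (((x k 0 : ℝ) : ℂ) + c k) * fderiv ℝ F x (Pi.single k (EuclideanSpace.single j.succ (1 : ℝ))) := by
    refine (hVc.mul (continuous_finsetSum _ fun k _ => ((hcoord k 0).add continuous_const).mul
      (hdF _))).integrable_of_hasCompactSupport (hsuppF fun x hx => ?_).mul_left
    simp [hzero _ hx]
  have hId : Integrable fun x : Fin n → SpaceTime d => 𝔚 (rayC x η ((t : ℂ) * I)) *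
      ∑ k, ((η k 0 : ℝ) : ℂ) * fderiv ℝ F x (Pi.single k (EuclideanSpace.single j.succ (1 : ℝ))) := by
    refine (hVc.mul (continuous_finsetSum _ fun k _ => continuous_const.mul
      (hdF _))).integrable_of_hasCompactSupport (hsuppF fun x hx => ?_).mul_left
    simp [hzero _ hx]
  have hT2 : ∫ x, 𝔚 (rayC x η ((t : ℂ) * I)) *
      ∑ k, (((x k 0 : ℝ) : ℂ) + c k) * fderiv ℝ F x (Pi.single k (EuclideanSpace.single j.succ (1 : ℝ))) =
      ∫ u : Fin n → ℝ, ∑ k, (((u k : ℝ) : ℂ) + c k) * ∫ y : Fin n → EuclideanSpace ℝ (Fin d),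
        𝔚 (tsCfg (fun k => ((u k : ℝ) : ℂ) + c k) y) *
          fderiv ℝ F (fun k => ofTimeSpace (u k) (y k)) (Pi.single k (EuclideanSpace.single j.succ (1 : ℝ))) := by
    rw [integral_eq_integral_integral_timeSpace hIc]
    simp only [hVasm, ofTimeSpace_apply_zero]
    congr 1
    funext u
    have hIy : ∀ k, Integrable fun y : Fin n → EuclideanSpace ℝ (Fin d) =>
        𝔚 (tsCfg (fun k => ((u k : ℝ) : ℂ) + c k) y) *
          fderiv ℝ F (fun k => ofTimeSpace (u k) (y k)) (Pi.single k (EuclideanSpace.single j.succ (1 : ℝ))) :=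
      fun k => ((hWu u).mul ((hdF _).comp (continuous_timeSpace.comp
        (continuous_const.prodMk continuous_id)))).integrable_of_hasCompactSupport
        (hasCompactSupport_comp_timeSpace_right (hdFc _) u).mul_left
    have hpt : ∀ y : Fin n → EuclideanSpace ℝ (Fin d),
        𝔚 (tsCfg (fun k => ((u k : ℝ) : ℂ) + c k) y) *
          ∑ k, (((u k : ℝ) : ℂ) + c k) * fderiv ℝ F (fun k => ofTimeSpace (u k) (y k))
            (Pi.single k (EuclideanSpace.single j.succ (1 : ℝ))) =
        ∑ k, (((u k : ℝ) : ℂ) + c k) * (𝔚 (tsCfg (fun k => ((u k : ℝ) : ℂ) + c k) y) *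
          fderiv ℝ F (fun k => ofTimeSpace (u k) (y k)) (Pi.single k (EuclideanSpace.single j.succ (1 : ℝ)))) :=
      fun y => by
        rw [Finset.mul_sum]
        exact Finset.sum_congr rfl fun k _ => by ring
    simp only [hpt]
    rw [integral_finsetSum _ fun k _ => (hIy k).const_mul _]
    simp only [integral_const_mul]
  -- Step 5: assembly
  have hIuy : ∀ k, Integrable (fun u : Fin n → ℝ => ∫ y : Fin n → EuclideanSpace ℝ (Fin d),
      fderiv ℂ (fun w => 𝔚 (tsCfg w y)) (fun k => ((u k : ℝ) : ℂ) + c k) (Pi.single k (1 : ℂ)) *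
        (((y k j : ℝ) : ℂ) * F (fun k => ofTimeSpace (u k) (y k)))) volume := fun k =>
    (integrable_fderiv_rayTimes_mul hc hh hcT hF.continuous hFc (hcoordY k) (Pi.single k (1 : ℂ))).integral_prod_left
  have hsplit : ∫ x, 𝔚 (rayC x η ((t : ℂ) * I)) *
      ∑ k, (((x k 0 : ℝ) : ℂ) + c k) * fderiv ℝ F x (Pi.single k (EuclideanSpace.single j.succ (1 : ℝ))) =
      (∑ k, ∫ x, 𝔚 (rayC x η ((t : ℂ) * I)) *
          (((x k 0 : ℝ) : ℂ) * fderiv ℝ F x (Pi.single k (EuclideanSpace.single j.succ (1 : ℝ))))) +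
        ((t : ℂ) * I) * ∫ x, 𝔚 (rayC x η ((t : ℂ) * I)) *
          ∑ k, ((η k 0 : ℝ) : ℂ) * fderiv ℝ F x (Pi.single k (EuclideanSpace.single j.succ (1 : ℝ))) := by
    rw [← integral_finsetSum _ fun k _ => hIj k, ← integral_const_mul,
      ← integral_add (integrable_finsetSum _ fun k _ => hIj k) (hId.const_mul _)]
    congr 1
    funext x
    simp only [hc_def]
    rw [Finset.mul_sum, Finset.mul_sum, Finset.mul_sum, ← Finset.sum_add_distrib]
    exact Finset.sum_congr rfl fun k _ => by ring
  rw [hstep1]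
  simp only [hT1]
  rw [Finset.sum_neg_distrib, ← integral_finsetSum _ fun k _ => hIuy k]
  simp only [hsum]
  rw [← hT2, hsplit]
  ring

/-- **The time-ray boundary value is annihilated by the infinitesimal boosts** (Osterwalder–
Schrader I (1973), §4.2, `X_{0j} W̃ₙ = 0`, (4.14), in position space): under E1, for `𝔚` continuous
on the time tube, holomorphic in the times, with Euclidean restriction `𝔖ₙ` and time-ray boundary
value `T`, `T(X_{0j} F) = 0` for every compactly supported test function `F`, where
`(X_{0j} F)(x) = DF(x)(b x)`, `(b x)_k = x_k^j e₀ + x_k⁰ e_j` (witness form: any Schwartz `G` with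
these values). Proof: let `t → 0⁺` in `integral_rayC_mul_fderiv_boostGen`, whose right side is
`−it` times a convergent quantity. [cite: OsterwalderSchraderCMP1973, §4.2 eq. (4.14)] -/
theorem _root_.Literature.MathematicalPhysics.QuantumFieldTheory.HasTimeRayBoundaryValue.apply_fderiv_boostGen_eq_zero
    (hE1 : S.IsEuclideanCovariant) (hc : ContinuousOn 𝔚 (timeTube d n))
    (hh : IsTimeHolomorphicOn 𝔚 (timeTube d n))
    (hS : ∀ F : 𝓢((Fin n → EuclideanSpace ℝ (Fin (d + 1))), ℂ), IsTimeOrdered F →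
      S n F = ∫ x, 𝔚 (euclideanPoint x) * F x)
    {T : 𝓢((Fin n → SpaceTime d), ℂ) →L[ℂ] ℂ} (hT : HasTimeRayBoundaryValue 𝔚 T) (j : Fin d)
    (F G : 𝓢((Fin n → SpaceTime d), ℂ)) (hFc : HasCompactSupport (F : (Fin n → SpaceTime d) → ℂ))
    (hG : ∀ x, G x = fderiv ℝ F x (fun k => (x k j.succ) • e₀ d +
      (x k 0) • EuclideanSpace.single j.succ (1 : ℝ))) :
    T G = 0 := by
  set η : Fin n → SpaceTime d := fun k => (((k : ℕ) : ℝ) + 1) • e₀ d with hη_def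
  have hη : η ∈ temporalCone d n := stdDirection_mem_temporalCone
  -- the test function on the right side
  let D : 𝓢((Fin n → SpaceTime d), ℂ) :=
    ∑ k, ((η k 0 : ℝ) : ℂ) • (LineDeriv.lineDerivOp
      (Pi.single k (EuclideanSpace.single j.succ (1 : ℝ)) : Fin n → SpaceTime d) F)
  have hD : ∀ x, D x = ∑ k, ((η k 0 : ℝ) : ℂ) *
      fderiv ℝ F x (Pi.single k (EuclideanSpace.single j.succ (1 : ℝ))) := fun x => by
    simp only [D, sum_apply, smul_apply, smul_eq_mul,
      SchwartzMap.lineDerivOp_apply_eq_fderiv]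
  have h1 := hT η hη G
  have h2 : Tendsto (fun t : ℝ => -(((t : ℂ) * I) * ∫ x : Fin n → SpaceTime d,
      𝔚 (fun k => complexifyPoint (x k) + ((t : ℂ) * I) • complexifyPoint (η k)) * D x))
      (𝓝[>] 0) (𝓝 0) := by
    have hD' := hT η hη D
    have ht0 : Tendsto (fun t : ℝ => (t : ℂ) * I) (𝓝[>] 0) (𝓝 0) := by
      have : Tendsto (fun t : ℝ => (t : ℂ) * I) (𝓝 0) (𝓝 ((0 : ℝ) * I)) :=
        (continuous_ofReal.mul continuous_const).tendsto 0
      simpa using this.mono_left nhdsWithin_le_nhds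
    simpa using (ht0.mul hD').neg
  have heq : ∀ᶠ t : ℝ in 𝓝[>] 0,
      (∫ x : Fin n → SpaceTime d,
        𝔚 (fun k => complexifyPoint (x k) + ((t : ℂ) * I) • complexifyPoint (η k)) * G x) =
      -(((t : ℂ) * I) * ∫ x : Fin n → SpaceTime d,
        𝔚 (fun k => complexifyPoint (x k) + ((t : ℂ) * I) • complexifyPoint (η k)) * D x) := by
    refine eventually_nhdsWithin_of_forall fun t (ht : 0 < t) => ?_
    simp only [hG, hD, ← rayC_mul_I]
    exact integral_rayC_mul_fderiv_boostGen hE1 hc hh hS j hη ht (F.smooth ⊤) hFc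
  exact tendsto_nhds_unique (h1.congr' heq) h2

end Literature.MathematicalPhysics.QuantumFieldTheory
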